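import Summits.CriticalPhenomena.PercolationContinuityZ3.Theorems.PercNearOneGluingNoHeavyLowerTailSahiCTCRtThreeSlotsAssign
import HarnessLib

/-!
# `NoHeavyLowerTail` (crux stmt-CriticalPhenomena-4575), P3 lane: the squarefree row of `R_3 ∈ ℕ[s]` when the deficient common edges share a vertex
# (the "hub" case of (F-ASSIGN), memo g48 §4d — covers the bridge and apex families and every pair with at most one deficient common edge)

Support file (seat `prim-l12-p3`, gen 48; `--supports stmt-CriticalPhenomena-4575`).  Memo
`run/shared/lean/prim/prim-l12/FROM-prim-l12-p3-g48-THREE-BLOCK-SLOTS.md` §4d.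

`coeff_ind_Rt_three_nonneg_of_assignment` (…SahiCTCRtThreeSlotsAssign) proves the squarefree row from a point assignment `R ↦ f R` on the small common
non-members.  Choosing the constant assignment `f R = u` shows:
* **`coeff_ind_Rt_three_nonneg_of_hub`** : if some vertex `u ∈ V` lies on every common edge that violates the plain c-slot inequality (i.e. every common
  edge `c ∌ u` satisfies `#reserved(c) ≤ κ(∅, V∖c) + #edge-sided crossings`), then `[s^V] R_3(𝒳,𝒵) ≥ 0` (loop-free pair, `#V ≥ 3`).
Nothing is asserted about the crux.
-/

noncomputable section

open scoped Classical

namespace Summit.CriticalPhenomena.PercolationContinuityZ3.Theorems.SahiCTCForms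

open Finset MvPolynomial SahiCTCGenFun

variable {α : Type*} [DecidableEq α] [Fintype α]

section Hub
variable {F G : Finset (Finset α)}

/-- **ROW 0 IN THE HUB CASE.**  If a vertex `u ∈ V` lies on every common edge whose c-slot inequality fails — precisely: every common edge `c ⊆ V` with
`u ∉ c` satisfies `#{R ⊆ V∖c small non-member : V∖(c∪R) common} ≤ κ(∅, V∖c) + #(edge-sided crossings of V∖c)` — then `[s^V] R_3(𝒳,𝒵) ≥ 0`.
Proof: the constant assignment `f R = u` in `coeff_ind_Rt_three_nonneg_of_assignment`; the slots of the edges through `u` keep nothing. [this work] -/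
theorem coeff_ind_Rt_three_nonneg_of_hub (hF : IsUpperSet (F : Set (Finset α))) (hG : IsUpperSet (G : Set (Finset α))) (V : Finset α)
    (hV : 3 ≤ #V) (h0F : ∅ ∉ F) (h1F : ∀ v ∈ V, ({v} : Finset α) ∉ F) (h1G : ∀ v ∈ V, ({v} : Finset α) ∉ G) {u : α} (hu : u ∈ V)
    (hc : ∀ c ∈ ((V.powerset.filter fun U => #U ≤ 2).filter fun U => U ∈ F).filter fun U => U ∈ G, u ∉ c →
      (#((V \ c).powerset.filter fun R => #R ≤ 2 ∧ R ∉ F ∧ R ∉ G ∧ (V \ c) \ R ∈ F ∧ (V \ c) \ R ∈ G) : ℤ)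
        ≤ kap F G ∅ (V \ c)
          + #((V \ c).powerset.filter fun a => #a = 2 ∧ a ∈ F ∧ a ∉ G ∧ (V \ c) \ a ∈ G ∧ (V \ c) \ a ∉ F)
          + #((V \ c).powerset.filter fun b => #b = 2 ∧ b ∈ G ∧ b ∉ F ∧ (V \ c) \ b ∈ F ∧ (V \ c) \ b ∉ G)) :
    0 ≤ (Rt 3 F G).coeff (ind V) := by
  -- the assignment: `u` whenever possible, otherwise any point outside `R`
  have hne : ∀ R ∈ ((V.powerset.filter fun U => #U ≤ 2).filter fun U => ¬ U ∈ F).filter fun U => ¬ U ∈ G, (V \ R).Nonempty := by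
    intro R hR
    have hR2 : #R ≤ 2 := (mem_filter.1 (mem_filter.1 (mem_filter.1 hR).1).1).2
    have hRV : R ⊆ V := mem_powerset.1 (mem_filter.1 (mem_filter.1 (mem_filter.1 hR).1).1).1
    rw [← card_pos, card_sdiff_of_subset hRV]; omega
  let f : Finset α → α := fun R => if u ∉ R then u else if h : (V \ R).Nonempty then h.choose else u
  refine coeff_ind_Rt_three_nonneg_of_assignment hF hG V h0F h1F h1G f (fun R hR => ?_) (fun c hcC => ?_)
  · show (if u ∉ R then u else if h : (V \ R).Nonempty then h.choose else u) ∈ V \ R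
    by_cases huR : u ∉ R
    · rw [if_pos huR]; exact mem_sdiff.2 ⟨hu, huR⟩
    · rw [if_neg huR, dif_pos (hne R hR)]; exact (hne R hR).choose_spec
  · have hk : (0 : ℤ) ≤ kap F G ∅ (V \ c) := kap_nonneg hF hG _ _ (disjoint_empty_left _)
    by_cases huc : u ∈ c
    · -- every reserved `R` of `c` avoids `u`, so `f R = u ∈ c`: nothing is kept at the slot `c`
      have h0 : ((V \ c).powerset.filter fun R => #R ≤ 2 ∧ R ∉ F ∧ R ∉ G ∧ (V \ c) \ R ∈ F ∧ (V \ c) \ R ∈ G ∧ f R ∉ c) = ∅ := by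
        refine filter_eq_empty_iff.2 fun R hR h => h.2.2.2.2.2 ?_
        have huR : u ∉ R := fun h' => (mem_sdiff.1 (mem_powerset.1 hR h')).2 huc
        show (if u ∉ R then u else if h : (V \ R).Nonempty then h.choose else u) ∈ c
        rw [if_pos huR]; exact huc
      rw [h0, card_empty, Nat.cast_zero]
      have h1 : (0 : ℤ) ≤ #((V \ c).powerset.filter fun a => #a = 2 ∧ a ∈ F ∧ a ∉ G ∧ (V \ c) \ a ∈ G ∧ (V \ c) \ a ∉ F) := Nat.cast_nonneg _
      have h2 : (0 : ℤ) ≤ #((V \ c).powerset.filter fun b => #b = 2 ∧ b ∈ G ∧ b ∉ F ∧ (V \ c) \ b ∈ F ∧ (V \ c) \ b ∉ G) := Nat.cast_nonneg _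
      linarith
    · refine le_trans ?_ (hc c hcC huc)
      exact_mod_cast card_le_card fun R hR => by
        obtain ⟨hRV, h1, h2, h3, h4, h5, -⟩ := mem_filter.1 hR
        exact mem_filter.2 ⟨hRV, h1, h2, h3, h4, h5⟩

end Hub

end Summit.CriticalPhenomena.PercolationContinuityZ3.Theorems.SahiCTCForms
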